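import Summits.QuantumFields.YangMills.Theorems.F4SubCurvatureDoorSliceFourierUniqueness
import Summits.QuantumFields.YangMills.Theorems.F4SubCurvatureDoorMirrorAnalyticityRegistered
import Summits.QuantumFields.YangMills.Theorems.F4SubCurvatureDoorMirrorContinuation
import Mathlib
import HarnessLib

/-!
# Route `F4SubCurvatureDoor`, crux ⟨stmt-QuantumFields-23035⟩ `ShortRootRigidity`: LINE g19-A «transverse slice» (planner ym-idea-3 g19, tree
# skeleton `Cruxes/ShortRootRigidity/Lines/transverse_slice.lean`) — registered stub `stub_sliceDensity` BY NAME AND SIGNATURE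

The name-keyed statements of the skeleton (`E2`, `planeEmb`, `perpEmb`, `weight`, `slice`, `EvenPartSliceInvariant`, `SliceDensity`) copied
VERBATIM into this file's own namespace (pattern of ✓`F4SubCurvatureDoorNullConePointednessRegistered`), and the registered stub
`theorem stub_sliceDensity : SliceDensity` proved from the def-free tree theorem
✓`F4SubCurvatureDoorSliceFourier.add_neg_eq_zero_of_integral_cosGauss_eq_zero` (Fourier uniqueness for the even part): for `y ≠ 0` and a plane
isometry `R`, the difference `g(x) = K(ι Ry + ι^⊥x) − K(ι y + ι^⊥x)` is continuous and bounded (`‖ι y + ι^⊥x‖² = ‖y‖² + ‖x‖²` keeps the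
arguments at distance `≥ ‖y‖` from `0`; `K` is continuous off `0` and bounded outside the unit ball), all its Gaussian–cosine moments vanish by
the hypothesis, so `g(x) + g(−x) = 0`; evenness of `K` (`W(B₄) ∋ −1`) turns this into even-part slice invariance.

Mathlib + tree only; no `sorry`; standard axioms.  HONEST FRAMING: support stub (3) «slice density» (S–M, Fourier uniqueness) of a freshly
filed line; the heart `stub_planarRigidity` (XL), stubs (1)/(4), crux 23035 / 23125, rung R2d (`BalabanLadder.ROT`) and every summit statement
are untouched; the Yang–Mills mass gap is NOT proved.  Width seat `ym-line-sfw-p2-w3` g35 (cell ym-idea-1, free hands).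
-/

set_option autoImplicit false

noncomputable section

namespace Summit.QuantumFields.YangMills.Theorems.F4SubCurvatureDoorSliceDensityRegistered

open scoped Topology BigOperators RealInnerProductSpace
open Filter Set MeasureTheory
open Summit.QuantumFields.YangMills.Theorems.F4SubCurvatureDoorMirrorAnalyticityRegistered (E4 InClass)
open Summit.QuantumFields.YangMills.Theorems.F4SubCurvatureDoorGlobalReduction (isSignedPerm_neg)
open Summit.QuantumFields.YangMills.Theorems.F4SubCurvatureDoorSliceFourier (add_neg_eq_zero_of_integral_cosGauss_eq_zero
  integrable_mul_gauss)

/-- The plane `ℝ²` (verbatim from the skeleton). -/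
abbrev E2 := EuclideanSpace ℝ (Fin 2)

/-- `ι : ℝ² → Π₀ ⊂ ℝ⁴`, `y ↦ y₀ e₀ + y₁ m`, `m = (0,1,1,1)/√3` (verbatim from the skeleton). -/
def planeEmb (y : E2) : E4 :=
  (WithLp.equiv 2 (Fin 4 → ℝ)).symm ![y 0, y 1 / Real.sqrt 3, y 1 / Real.sqrt 3, y 1 / Real.sqrt 3]

/-- `ι^⊥ : ℝ² → Π₀^⊥ ⊂ ℝ⁴`, `x ↦ x₀ b₁ + x₁ b₂`, `b₁ = (0,1,−1,0)/√2`, `b₂ = (0,1,1,−2)/√6` (verbatim from the skeleton). -/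
def perpEmb (x : E2) : E4 :=
  (WithLp.equiv 2 (Fin 4 → ℝ)).symm
    ![0, x 0 / Real.sqrt 2 + x 1 / Real.sqrt 6, -(x 0 / Real.sqrt 2) + x 1 / Real.sqrt 6, -(2 * x 1 / Real.sqrt 6)]

/-- The Gaussian–cosine weight `w_a(x) = cos⟪a,x⟫ e^{−‖x‖²/2}` (verbatim from the skeleton). -/
def weight (a x : E2) : ℝ := Real.cos (inner ℝ a x) * Real.exp (-(‖x‖ ^ 2 / 2))

/-- The transverse slice `y ↦ ∫ K(ι y + ι^⊥ x) w_a(x) dx` (verbatim from the skeleton). -/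
def slice (K : E4 → ℝ) (a : E2) (y : E2) : ℝ := ∫ x : E2, K (planeEmb y + perpEmb x) * weight a x

/-- Even-part slice invariance of `K` along `Π₀` (verbatim from the skeleton). -/
def EvenPartSliceInvariant (K : E4 → ℝ) : Prop :=
  ∀ (R : E2 ≃ₗᵢ[ℝ] E2) (y x : E2),
    K (planeEmb (R y) + perpEmb x) + K (-planeEmb (R y) + perpEmb x) =
      K (planeEmb y + perpEmb x) + K (-planeEmb y + perpEmb x)

/-- Obligation (3) «SLICE DENSITY» (verbatim from the skeleton). -/
def SliceDensity : Prop :=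
  ∀ K : E4 → ℝ, InClass K →
    (∀ (a : E2) (R : E2 ≃ₗᵢ[ℝ] E2) (y : E2), y ≠ 0 → slice K a (R y) = slice K a y) →
    EvenPartSliceInvariant K

/-! ## Geometry of the two frames -/

/-- Coordinate `0` of `ι y + ι^⊥ x`. -/
theorem planeEmb_add_perpEmb_apply_zero (y x : E2) : (planeEmb y + perpEmb x) 0 = y 0 := by
  simp [planeEmb, perpEmb]

/-- Coordinate `1` of `ι y + ι^⊥ x`. -/
theorem planeEmb_add_perpEmb_apply_one (y x : E2) :
    (planeEmb y + perpEmb x) 1 = y 1 / Real.sqrt 3 + (x 0 / Real.sqrt 2 + x 1 / Real.sqrt 6) := by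
  simp [planeEmb, perpEmb]

/-- Coordinate `2` of `ι y + ι^⊥ x`. -/
theorem planeEmb_add_perpEmb_apply_two (y x : E2) :
    (planeEmb y + perpEmb x) 2 = y 1 / Real.sqrt 3 + (-(x 0 / Real.sqrt 2) + x 1 / Real.sqrt 6) := by
  simp [planeEmb, perpEmb]

/-- Coordinate `3` of `ι y + ι^⊥ x`. -/
theorem planeEmb_add_perpEmb_apply_three (y x : E2) :
    (planeEmb y + perpEmb x) 3 = y 1 / Real.sqrt 3 + -(2 * x 1 / Real.sqrt 6) := by
  simp [planeEmb, perpEmb]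

/-- ★ **Pythagoras for the two frames**: `‖ι y + ι^⊥ x‖² = ‖y‖² + ‖x‖²` (`Π₀ ⊥ Π₀^⊥`, both frames orthonormal). -/
theorem norm_sq_planeEmb_add_perpEmb (y x : E2) : ‖planeEmb y + perpEmb x‖ ^ 2 = ‖y‖ ^ 2 + ‖x‖ ^ 2 := by
  rw [EuclideanSpace.real_norm_sq_eq, EuclideanSpace.real_norm_sq_eq, EuclideanSpace.real_norm_sq_eq,
    Fin.sum_univ_four, Fin.sum_univ_two, Fin.sum_univ_two, planeEmb_add_perpEmb_apply_zero, planeEmb_add_perpEmb_apply_one,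
    planeEmb_add_perpEmb_apply_two, planeEmb_add_perpEmb_apply_three]
  have h2 : Real.sqrt 2 ^ 2 = 2 := Real.sq_sqrt (by norm_num)
  have h3 : Real.sqrt 3 ^ 2 = 3 := Real.sq_sqrt (by norm_num)
  have h6 : Real.sqrt 6 ^ 2 = 6 := Real.sq_sqrt (by norm_num)
  have hA : 3 * (y 1 / Real.sqrt 3) ^ 2 = (y 1) ^ 2 := by
    rw [div_pow, h3]; field_simp
  have hB : 2 * (x 0 / Real.sqrt 2) ^ 2 = (x 0) ^ 2 := by
    rw [div_pow, h2]; field_simp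
  have hC : 6 * (x 1 / Real.sqrt 6) ^ 2 = (x 1) ^ 2 := by
    rw [div_pow, h6]; field_simp
  have hC' : (2 * x 1 / Real.sqrt 6) = 2 * (x 1 / Real.sqrt 6) := by ring
  rw [hC']
  linear_combination hA + hB + hC

/-- `ι^⊥(−x) = −ι^⊥ x`. -/
theorem perpEmb_neg (x : E2) : perpEmb (-x) = -perpEmb x := by
  ext i
  simp only [perpEmb, WithLp.equiv_symm_apply, PiLp.neg_apply, PiLp.toLp_apply]
  fin_cases i <;> simp <;> ring

/-- `ι^⊥` is continuous. -/
theorem continuous_perpEmb : Continuous perpEmb := by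
  unfold perpEmb
  simp only [WithLp.equiv_symm_apply]
  refine (PiLp.continuous_toLp 2 _).comp ?_
  refine continuous_pi fun i => ?_
  fin_cases i <;> simp <;> fun_prop

/-- For `y ≠ 0` the points `ι y + ι^⊥ x` stay off `0`. -/
theorem planeEmb_add_perpEmb_ne_zero {y : E2} (hy : y ≠ 0) (x : E2) : planeEmb y + perpEmb x ≠ 0 := by
  intro h
  have hn := norm_sq_planeEmb_add_perpEmb y x
  rw [h, norm_zero] at hn
  have : ‖y‖ ^ 2 = 0 := by nlinarith [sq_nonneg ‖x‖, sq_nonneg ‖y‖]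
  exact hy (norm_eq_zero.1 (pow_eq_zero_iff (two_ne_zero) |>.1 this))

/-- For `y ≠ 0`, `x ↦ K(ι y + ι^⊥ x)` is continuous when `K` is continuous off `0`. -/
theorem continuous_comp_slice {K : E4 → ℝ} (hK : ContinuousOn K {x | x ≠ 0}) {y : E2} (hy : y ≠ 0) :
    Continuous fun x : E2 => K (planeEmb y + perpEmb x) :=
  hK.comp_continuous (continuous_const.add continuous_perpEmb) fun x => planeEmb_add_perpEmb_ne_zero hy x

/-- For `y ≠ 0`, `x ↦ K(ι y + ι^⊥ x)` is bounded when `K` is continuous off `0` and bounded outside the unit ball. -/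
theorem exists_bound_comp_slice {K : E4 → ℝ} (hK : ContinuousOn K {x | x ≠ 0}) (hb : ∃ C : ℝ, ∀ x, 1 ≤ ‖x‖ → |K x| ≤ C)
    {y : E2} (hy : y ≠ 0) : ∃ C : ℝ, ∀ x : E2, |K (planeEmb y + perpEmb x)| ≤ C := by
  obtain ⟨C, hC⟩ := hb
  -- inside the unit ball the transverse coordinate is confined to the unit disc, a compact set
  obtain ⟨C', hC'⟩ := (isCompact_closedBall (0 : E2) 1).exists_bound_of_continuousOn
    ((continuous_comp_slice hK hy).continuousOn)
  refine ⟨max C C', fun x => ?_⟩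
  by_cases h1 : 1 ≤ ‖planeEmb y + perpEmb x‖
  · exact (hC _ h1).trans (le_max_left _ _)
  · have hx : x ∈ Metric.closedBall (0 : E2) 1 := by
      rw [Metric.mem_closedBall, dist_zero_right]
      have hn := norm_sq_planeEmb_add_perpEmb y x
      have hlt : ‖planeEmb y + perpEmb x‖ < 1 := not_le.1 h1
      nlinarith [norm_nonneg (planeEmb y + perpEmb x), norm_nonneg x, sq_nonneg ‖y‖, norm_nonneg y]
    have := hC' x hx
    rw [Real.norm_eq_abs] at this
    exact this.trans (le_max_right _ _)

/-! ## The registered stub -/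

/-- **Registered stub (3) of LINE g19-A, BY NAME AND SIGNATURE**: `SliceDensity` holds — rotation invariance of all Gaussian–cosine
transverse slices forces even-part slice invariance (Fourier uniqueness for even functions, `add_neg_eq_zero_of_integral_cosGauss_eq_zero`).
[folklore] -/
theorem stub_sliceDensity : SliceDensity := by
  intro K hK hrot R y x
  by_cases hy : y = 0
  · subst hy; simp
  have hRy : R y ≠ 0 := fun h => hy (by simpa using congrArg R.symm h)
  obtain ⟨hcont, hbdd, hB4, -, -, -⟩ := hK
  -- evenness of `K`
  have heven : ∀ v : E4, K (-v) = K v := fun v => by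
    have h := hB4 (LinearIsometryEquiv.neg ℝ) isSignedPerm_neg v
    simpa using h
  -- the difference of the two slice integrands
  set g : E2 → ℝ := fun x' => K (planeEmb (R y) + perpEmb x') - K (planeEmb y + perpEmb x') with hg
  have hg_cont : Continuous g := (continuous_comp_slice hcont hRy).sub (continuous_comp_slice hcont hy)
  obtain ⟨C₁, hC₁⟩ := exists_bound_comp_slice hcont hbdd hRy
  obtain ⟨C₂, hC₂⟩ := exists_bound_comp_slice hcont hbdd hy
  have hg_bd : ∀ x', |g x'| ≤ C₁ + C₂ := fun x' => (abs_sub _ _).trans (add_le_add (hC₁ x') (hC₂ x'))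
  -- its Gaussian–cosine moments vanish
  have hmom : ∀ a : E2, ∫ x', g x' * (Real.cos ⟪a, x'⟫ * Real.exp (-(‖x'‖ ^ 2 / 2))) = 0 := by
    intro a
    have hca : Continuous fun x' : E2 => Real.cos ⟪a, x'⟫ := Real.continuous_cos.comp (continuous_const.inner continuous_id)
    have hf1 : Continuous fun x' : E2 => K (planeEmb (R y) + perpEmb x') * Real.cos ⟪a, x'⟫ :=
      (continuous_comp_slice hcont hRy).mul hca
    have hf2 : Continuous fun x' : E2 => K (planeEmb y + perpEmb x') * Real.cos ⟪a, x'⟫ :=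
      (continuous_comp_slice hcont hy).mul hca
    have hi1 : Integrable fun x' : E2 => K (planeEmb (R y) + perpEmb x') * (Real.cos ⟪a, x'⟫ * Real.exp (-(‖x'‖ ^ 2 / 2))) := by
      have := integrable_mul_gauss hf1 (C := C₁ * 1) (fun x' => by
        rw [abs_mul]; exact mul_le_mul (hC₁ x') (Real.abs_cos_le_one _) (abs_nonneg _) ((abs_nonneg _).trans (hC₁ x')))
      exact this.congr (ae_of_all _ fun x' => by ring)
    have hi2 : Integrable fun x' : E2 => K (planeEmb y + perpEmb x') * (Real.cos ⟪a, x'⟫ * Real.exp (-(‖x'‖ ^ 2 / 2))) := by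
      have := integrable_mul_gauss hf2 (C := C₂ * 1) (fun x' => by
        rw [abs_mul]; exact mul_le_mul (hC₂ x') (Real.abs_cos_le_one _) (abs_nonneg _) ((abs_nonneg _).trans (hC₂ x')))
      exact this.congr (ae_of_all _ fun x' => by ring)
    have h := hrot a R y hy
    simp only [slice, weight] at h
    calc ∫ x', g x' * (Real.cos ⟪a, x'⟫ * Real.exp (-(‖x'‖ ^ 2 / 2)))
        = ∫ x', (K (planeEmb (R y) + perpEmb x') * (Real.cos ⟪a, x'⟫ * Real.exp (-(‖x'‖ ^ 2 / 2))) -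
            K (planeEmb y + perpEmb x') * (Real.cos ⟪a, x'⟫ * Real.exp (-(‖x'‖ ^ 2 / 2)))) :=
          integral_congr_ae (ae_of_all _ fun x' => by simp only [hg]; ring)
      _ = 0 := by rw [integral_sub hi1 hi2, h, sub_self]
  -- Fourier uniqueness for the even part
  have hzero := add_neg_eq_zero_of_integral_cosGauss_eq_zero hg_cont hg_bd hmom x
  simp only [hg, perpEmb_neg] at hzero
  -- `K(ι Ry − ι^⊥ x) = K(−ι Ry + ι^⊥ x)` by evenness
  have e1 : K (planeEmb (R y) + -perpEmb x) = K (-planeEmb (R y) + perpEmb x) := by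
    rw [← heven (-planeEmb (R y) + perpEmb x), neg_add, neg_neg]
  have e2 : K (planeEmb y + -perpEmb x) = K (-planeEmb y + perpEmb x) := by
    rw [← heven (-planeEmb y + perpEmb x), neg_add, neg_neg]
  rw [e1, e2] at hzero
  linarith

end Summit.QuantumFields.YangMills.Theorems.F4SubCurvatureDoorSliceDensityRegistered

end
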